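import Mathlib
import Literature.Computability.AlgebraicComplexity.BurgisserBooleanPartsA3Steps
import Literature.Computability.AlgebraicComplexity.CommutativeExtensionSimulation
import Literature.Computability.AlgebraicComplexity.RealTauConjectureDepthFour
import Literature.Computability.AlgebraicComplexity.RazElusiveGeneralRouteProofs
import Literature.Computability.AlgebraicComplexity.ValiantClassesProofs
import HarnessLib

/-!
# Route NumTame — the finite-place reduction behind `LowDegreeRegime` (support for
# stmt-ValiantsHypothesis-5391): algebraic-integer constants of bounded degree ⇒ a small circuit
# modulo every prime with the same Boolean values

The intended content of `LowDegreeRegime` (the GRH-free "finite-place twin"; the item as filed is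
mis-typed by a junk quantifier — `K = ⊤` has `finrank 0` —, refuters g42-8 / route review, fix
`FiniteDimensional ℚ K`): a fan-in-two circuit `P` over `ℂ` whose constants and sum weights are
ALGEBRAIC INTEGERS lying in a number field `K ⊂ ℂ`, `[K:ℚ] = D`, and whose values at Boolean points
are natural numbers `φ(x)`, can be replaced — for EVERY prime `p` — by a fan-in-two circuit over
`ZMod p` of size `≤ (5D³ + 6D² + 2D)·3|P| + 3D` whose Boolean values are `φ(x) mod p`
(`exists_zmod_circuit_of_integral_constants`). No residue FIELD, no Chebotarev density, no height
bound is needed: the constants generate a ring `A = ℤ[c₁,…] ⊂ K`, finite free over `ℤ` of rank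
`≤ D` (integral generators; `ℤ`-independent ⇒ `ℚ`-independent), `p` is not a unit of `A` (`1/p` is
not an algebraic integer), so `B = A/pA` is a commutative `𝔽_p`-algebra of dimension `≤ D`; the
integer SKELETON of `P` (Bürgisser's `skeleton`/`slotConst`, tree) evaluates over `A`, reduces to
`B`, and a linear functional `ℓ : B → 𝔽_p` with `ℓ(1) = 1` read coefficientwise
(`CommExtSim.lmap`, Hrubeš–Yehudayoff simulation `CommExtSim.complexity_lmap_le`, tree) gives an
`𝔽_p`-polynomial of small complexity with the right Boolean values.

Contents: `slotConst_induction` (every slot constant of the skeleton is `0`, a sum weight, or an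
operand/output constant), `not_isUnit_natCast_prime` (a prime is not a unit in a ring of algebraic
integers inside `ℂ`), `finrank_int_le_of_le` (rank of a finite free `ℤ`-subalgebra of `K` ≤ `[K:ℚ]`),
`finrank_zmod_quotient_le` (`dim_{𝔽_p} A/pA ≤ rank_ℤ A`), `eval_lmap` (reading a functional
commutes with evaluation at `𝔽_p`-points), and the reduction theorem.

Honest framing: support for a conditional route (NumTame); `VP ≠ VNP` is NOT proved and nothing
here is progress on it.

## References

* P. Bürgisser, *Cook's versus Valiant's hypothesis*, Theoret. Comput. Sci. 235 (2000), §4 (the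
  reduction of algebraic constants modulo primes; here at one prime, degree-bounded, GRH-free) and
  §5 (A3). [cite: Burgisser2000TCS, §4 and §5 (A3)]
* P. Hrubeš, A. Yehudayoff, *Arithmetic complexity in ring extensions*, Theory Comput. 7 (2011),
  Thm 4.2 (tree: `CommExtSim.complexity_lmap_le`). [cite: HrubesYehudayoff2011, Thm 4.2]
-/

set_option linter.dupNamespace false

noncomputable section

open MvPolynomial

namespace Summit.ValiantsHypothesis.ValiantsHypothesis.Theorems.NumTame

open Literature.Computability.AlgebraicComplexity ArithCircuit

/-! ### §1. The slot constants of the skeleton -/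

/-- **Every slot constant of Bürgisser's skeleton is `0`, a sum weight of `P`, an operand constant of
`P`, or the output constant of `P`**: a predicate holding for these holds for all `slotConst P i`.
[cite: Burgisser2000TCS, §5 (A3) p. 85] -/
theorem slotConst_induction {k : Type*} [CommRing k] {σ : Type*} (P : ArithCircuit k σ)
    (Q₀ : k → Prop) (h0 : Q₀ 0)
    (hconst : ∀ g ∈ P.gates, ∀ u ∈ Gate.args g, ∀ a, u = Operand.const a → Q₀ a)
    (hw : ∀ args, Gate.sum args ∈ P.gates → ∀ a ∈ args, Q₀ a.1)
    (hout : ∀ a, P.output = Operand.const a → Q₀ a) (i : ℕ) : Q₀ (slotConst P i) := by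
  have hop : ∀ u : Operand k σ, (∀ a, u = Operand.const a → Q₀ a) → Q₀ (operandConst u) := by
    intro u hu
    cases u with
    | var _ => exact h0
    | const c => exact hu c rfl
    | gate _ => exact h0
  unfold slotConst
  split_ifs with hi hmod
  · exact hop _ hout
  · -- even slot: a sum weight (or `0`)
    split
    · exact h0
    · rename_i args hg
      have hmem : Gate.sum args ∈ P.gates := List.mem_of_getElem? hg
      split
      · exact h0
      · rename_i a ha
        exact hw args hmem a (List.mem_of_getElem? ha)
    · split
      · exact h0
      · exact h0
  · -- odd slot: an operand constant (or `0`)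
    split
    · exact h0
    · rename_i args hg
      have hmem : Gate.sum args ∈ P.gates := List.mem_of_getElem? hg
      split
      · exact h0
      · rename_i a ha
        have hamem : a ∈ args := List.mem_of_getElem? ha
        exact hop _ fun c hc => hconst _ hmem a.2
          (by simp only [Gate.args, List.mem_map]; exact ⟨a, hamem, rfl⟩) c hc
    · rename_i args hg
      have hmem : Gate.prod args ∈ P.gates := List.mem_of_getElem? hg
      split
      · exact h0
      · rename_i u hu
        exact hop _ fun c hc => hconst _ hmem u
          (by simpa [Gate.args] using List.mem_of_getElem? hu) c hc

/-! ### §2. Rings of algebraic integers inside `ℂ` -/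

/-- **A prime is not a unit in a ring of algebraic integers inside `ℂ`**: if every element of a
subalgebra `A ⊆ ℂ` is integral over `ℤ`, then `p` is not invertible in `A` (`1/p` is not an
algebraic integer: `ℤ` is integrally closed). [folklore] -/
theorem not_isUnit_natCast_prime (A : Subalgebra ℤ ℂ) (hA : ∀ x : A, IsIntegral ℤ (x : ℂ))
    (p : ℕ) (hp : p.Prime) : ¬ IsUnit ((p : A)) := by
  intro hu
  obtain ⟨u, hu⟩ := hu.exists_right_inv
  have hu' : (p : ℂ) * (u : ℂ) = 1 := by
    have := congrArg (fun x : A => (x : ℂ)) hu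
    simpa using this
  have hp0 : (p : ℂ) ≠ 0 := by exact_mod_cast hp.ne_zero
  -- `u = 1/p` is integral over `ℤ`, hence an integer
  have hq : ((Rat.castHom ℂ) ((p : ℚ)⁻¹)) = (u : ℂ) := by
    rw [map_inv₀, map_natCast]
    exact (eq_inv_of_mul_eq_one_right hu').symm
  have hint : IsIntegral ℤ ((p : ℚ)⁻¹) := by
    rw [← isIntegral_algHom_iff (Rat.castHom ℂ).toIntAlgHom (Rat.castHom ℂ).injective]
    change IsIntegral ℤ ((Rat.castHom ℂ) ((p : ℚ)⁻¹))
    rw [hq]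
    exact hA u
  obtain ⟨y, hy⟩ := IsIntegrallyClosed.isIntegral_iff.mp hint
  have hy' : (y : ℚ) * p = 1 := by
    rw [show ((y : ℚ)) = algebraMap ℤ ℚ y from rfl, hy]
    exact inv_mul_cancel₀ (by exact_mod_cast hp.ne_zero)
  have hyz : y * (p : ℤ) = 1 := by exact_mod_cast hy'
  rcases Int.eq_one_or_neg_one_of_mul_eq_one' hyz with ⟨-, h1⟩ | ⟨-, h1⟩
  · exact hp.ne_one (by exact_mod_cast h1)
  · have : (0 : ℤ) ≤ p := Int.natCast_nonneg p
    omega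

/-- **The rank of a finitely generated subring of a number field**: a `ℤ`-subalgebra `A ⊆ ℂ`
contained in an intermediate field `K` with `[K:ℚ] < ∞`, finite and free over `ℤ`, has
`rank_ℤ A ≤ [K:ℚ]` (a `ℤ`-basis of `A` is `ℚ`-linearly independent in `K`). [folklore] -/
theorem finrank_int_le_of_le (A : Subalgebra ℤ ℂ) (K : IntermediateField ℚ ℂ)
    [FiniteDimensional ℚ K] [Module.Finite ℤ A] [Module.Free ℤ A]
    (hAK : ∀ x : A, (x : ℂ) ∈ K) : Module.finrank ℤ A ≤ Module.finrank ℚ K := by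
  classical
  let bA := Module.Free.chooseBasis ℤ A
  let f : A →ₗ[ℤ] K :=
    { toFun := fun a => ⟨(a : ℂ), hAK a⟩
      map_add' := fun a b => by ext; simp
      map_smul' := fun n a => by ext; simp }
  have hf : Function.Injective f := by
    intro a b h
    have := congrArg (fun x : K => (x : ℂ)) h
    exact Subtype.ext (by simpa [f] using this)
  have hli : LinearIndependent ℤ (f ∘ bA) := bA.linearIndependent.map' f (LinearMap.ker_eq_bot.mpr hf)
  have hliQ : LinearIndependent ℚ (f ∘ bA) := (LinearIndependent.iff_fractionRing ℤ ℚ).mp hli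
  rw [Module.finrank_eq_card_chooseBasisIndex]
  exact hliQ.fintype_card_le_finrank

/-- **`dim_{𝔽_p} (A / I) ≤ rank_ℤ A`** for a finite free `ℤ`-algebra `A` and a quotient that
is a `ZMod p`-module: the images of a `ℤ`-basis span the quotient over `ZMod p`. [folklore] -/
theorem finite_and_finrank_zmod_quotient_le (A : Type) [CommRing A] [Module.Finite ℤ A]
    [Module.Free ℤ A] (I : Ideal A) (p : ℕ) [Fact p.Prime] [Module (ZMod p) (A ⧸ I)] :
    Module.Finite (ZMod p) (A ⧸ I) ∧ Module.finrank (ZMod p) (A ⧸ I) ≤ Module.finrank ℤ A := by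
  classical
  let π : A →+* A ⧸ I := Ideal.Quotient.mk I
  let bA := Module.Free.chooseBasis ℤ A
  -- the images of the basis span the quotient over `ZMod p`
  have hspan : Submodule.span (ZMod p)
      (Set.range fun i : Module.Free.ChooseBasisIndex ℤ A => π (bA i)) = ⊤ := by
    rw [eq_top_iff]
    rintro b -
    obtain ⟨a, rfl⟩ := Ideal.Quotient.mk_surjective b
    have ha : a = ∑ i, (bA.repr a i) • bA i := (bA.sum_repr a).symm
    rw [ha, map_sum]
    refine Submodule.sum_mem _ fun i _ => ?_
    rw [map_zsmul, ← Int.cast_smul_eq_zsmul (ZMod p)]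
    exact Submodule.smul_mem _ _ (Submodule.subset_span ⟨i, rfl⟩)
  have hfin : Module.Finite (ZMod p) (A ⧸ I) := by
    refine ⟨?_⟩
    rw [← hspan]
    exact Submodule.fg_span (Set.finite_range _)
  refine ⟨hfin, ?_⟩
  rw [← finrank_top (ZMod p) (A ⧸ I), ← hspan]
  calc Module.finrank (ZMod p)
        ↥(Submodule.span (ZMod p) (Set.range fun i : Module.Free.ChooseBasisIndex ℤ A => π (bA i)))
      ≤ Fintype.card (Module.Free.ChooseBasisIndex ℤ A) :=
        finrank_range_le_card (R := ZMod p) fun i : Module.Free.ChooseBasisIndex ℤ A => π (bA i)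
    _ = Module.finrank ℤ A := (Module.finrank_eq_card_chooseBasisIndex ℤ A).symm

/-! ### §3. Reading a functional commutes with evaluation at rational points -/

/-- For a `k`-linear functional `φ : R → k` and a point `y ∈ k^σ`:
`(lmap φ F)(y) = φ (F(y))` (`F(y)` computed in `R`). [folklore] -/
theorem eval_lmap {k : Type*} [CommRing k] {R : Type*} [CommRing R] [Algebra k R] {σ : Type*}
    (φ : R →ₗ[k] k) (F : MvPolynomial σ R) (y : σ → k) :
    eval y (CommExtSim.lmap φ F) = φ (eval (fun i => algebraMap k R (y i)) F) := by
  classical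
  induction F using MvPolynomial.induction_on' with
  | monomial m r =>
    have hl : CommExtSim.lmap φ (monomial m r) = monomial m (φ r) := by
      ext m'
      simp only [CommExtSim.coeff_lmap, coeff_monomial]
      split_ifs <;> simp
    rw [hl, eval_monomial, eval_monomial]
    have hprod : (m.prod fun i e => algebraMap k R (y i) ^ e) =
        algebraMap k R (m.prod fun i e => y i ^ e) := by
      simp only [Finsupp.prod, map_prod, map_pow]
    rw [hprod, mul_comm r, ← Algebra.smul_def, map_smul, smul_eq_mul, mul_comm]
  | add F G hF hG => rw [CommExtSim.lmap_add, map_add, map_add, hF, hG, map_add]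

/-! ### §4. The reduction -/

/-- Evaluation at Boolean points commutes with a ring homomorphism. [folklore] -/
theorem ringHom_eval_boolPoint {R S : Type*} [CommRing R] [CommRing S] {σ : Type*} (f : R →+* S)
    (G : MvPolynomial σ R) (x : σ → Bool) :
    f (eval (boolPoint R x) G) = eval (boolPoint S x) (MvPolynomial.map f G) := by
  have key : f.comp (eval (boolPoint R x)) = eval₂Hom f (boolPoint S x) :=
    MvPolynomial.ringHom_ext (fun r => by simp) (fun i => by
      by_cases h : x i <;> simp [boolPoint_apply, h])
  rw [MvPolynomial.eval_map]
  exact RingHom.congr_fun key G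

/-- **Reduction of a circuit with algebraic-integer constants of bounded degree modulo a prime.**
Let `P` be a fan-in-two circuit over `ℂ` whose operand constants, sum weights and output constant
are algebraic integers lying in an intermediate field `K ⊂ ℂ` with `[K:ℚ] < ∞`, and whose values at
Boolean points are the natural numbers `φ x`. Then for every prime `p` there is a fan-in-two circuit
over `ZMod p` of size `≤ (5D³+6D²+2D)·(3|P|) + 3D`, `D = [K:ℚ]`, whose value at every Boolean
point is `φ x mod p`. (Skeleton over `A = ℤ[constants] ⊂ K`, reduction to `B = A/pA`, a functional
`ℓ : B → 𝔽_p` with `ℓ 1 = 1`, Hrubeš–Yehudayoff simulation of `B` over `𝔽_p`.)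
[cite: Burgisser2000TCS, §4 and §5 (A3)] -/
theorem exists_zmod_circuit_of_integral_constants {n : ℕ} (K : IntermediateField ℚ ℂ)
    [FiniteDimensional ℚ K] (P : ArithCircuit ℂ (Fin n)) (h2 : P.IsFanInTwo)
    (hconst : ∀ g ∈ P.gates, ∀ u ∈ Gate.args g, ∀ a : ℂ, u = Operand.const a →
      a ∈ K ∧ IsIntegral ℤ a)
    (hw : ∀ args, Gate.sum args ∈ P.gates → ∀ a ∈ args, a.1 ∈ K ∧ IsIntegral ℤ a.1)
    (hout : ∀ a : ℂ, P.output = Operand.const a → a ∈ K ∧ IsIntegral ℤ a)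
    (φ : (Fin n → Bool) → ℕ) (hval : ∀ x, eval (boolPoint ℂ x) P.eval = (φ x : ℂ))
    (p : ℕ) [Fact p.Prime] :
    ∃ Q : ArithCircuit (ZMod p) (Fin n), Q.IsFanInTwo ∧
      Q.size ≤ (5 * Module.finrank ℚ K ^ 3 + 6 * Module.finrank ℚ K ^ 2 +
        2 * Module.finrank ℚ K) * (3 * P.size) + 3 * Module.finrank ℚ K ∧
      ∀ x, eval (boolPoint (ZMod p) x) Q.eval = (φ x : ZMod p) := by
  classical
  have hp : p.Prime := Fact.out
  -- the slot constants and the ring they generate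
  set s := P.size with hs
  let y : Fin (4 * s + 1) → ℂ := fun v => slotConst P v
  have hy : ∀ v, y v ∈ K ∧ IsIntegral ℤ (y v) := fun v =>
    slotConst_induction P (fun c => c ∈ K ∧ IsIntegral ℤ c) ⟨K.zero_mem, isIntegral_zero⟩
      hconst hw hout v
  let S : Set ℂ := Set.range y
  have hSfin : S.Finite := Set.finite_range y
  have hSint : ∀ c ∈ S, IsIntegral ℤ c := by rintro c ⟨v, rfl⟩; exact (hy v).2
  let A : Subalgebra ℤ ℂ := Algebra.adjoin ℤ S
  haveI hAfin : Module.Finite ℤ A := Algebra.finite_adjoin_of_finite_of_isIntegral hSfin hSint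
  have hAK : ∀ x : A, (x : ℂ) ∈ K := by
    have hle : A ≤ (K.toSubalgebra).restrictScalars ℤ :=
      Algebra.adjoin_le (by rintro c ⟨v, rfl⟩; exact (hy v).1)
    exact fun x => hle x.2
  have hAint : ∀ x : A, IsIntegral ℤ (x : ℂ) := fun x =>
    (isIntegral_algHom_iff A.val Subtype.val_injective).mpr (Algebra.IsIntegral.isIntegral x)
  haveI : Module.Free ℤ A := Module.free_of_finite_type_torsion_free'
  have hrank : Module.finrank ℤ A ≤ Module.finrank ℚ K := finrank_int_le_of_le A K hAK
  -- the skeleton evaluated over `A`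
  let yA : Fin (4 * s + 1) → A := fun v => ⟨y v, Algebra.subset_adjoin ⟨v, rfl⟩⟩
  let F : MvPolynomial (Fin n ⊕ Fin (4 * s + 1)) ℤ := (skeleton P).eval
  let GA : MvPolynomial (Fin n) A := aeval (Sum.elim X fun v => C (yA v)) F
  have hskel : aeval (slotSubst P) (skeleton P).eval = P.eval := aeval_slotSubst_skeleton P h2
  have hGA : MvPolynomial.map (algebraMap A ℂ) GA = P.eval := by
    rw [← hskel]
    have key : (MvPolynomial.map (algebraMap (↥A) ℂ)).comp
        (aeval (Sum.elim X fun v => C (yA v)) :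
          MvPolynomial (Fin n ⊕ Fin (4 * s + 1)) ℤ →ₐ[ℤ] MvPolynomial (Fin n) A).toRingHom =
        (aeval (slotSubst P) :
          MvPolynomial (Fin n ⊕ Fin (4 * s + 1)) ℤ →ₐ[ℤ] MvPolynomial (Fin n) ℂ).toRingHom := by
      refine MvPolynomial.ringHom_ext (fun r => ?_) (fun i => ?_)
      · simp only [AlgHom.toRingHom_eq_coe, eq_intCast, map_intCast]
      · rcases i with i | v
        · simp [slotSubst]
        · simp [slotSubst, yA, y]
    exact RingHom.congr_fun key F
  have hGAval : ∀ x, eval (boolPoint A x) GA = (φ x : A) := by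
    intro x
    apply Subtype.val_injective
    have h1 := ringHom_eval_boolPoint (algebraMap A ℂ) GA x
    rw [hGA, hval x] at h1
    change ((eval (boolPoint (↥A) x) GA : A) : ℂ) = ((φ x : A) : ℂ)
    rw [show ((eval (boolPoint (↥A) x) GA : A) : ℂ) = algebraMap A ℂ (eval (boolPoint A x) GA)
      from rfl, h1]
    simp
  -- complexity of `GA` over `A`
  have hcGA : complexity GA ≤ 3 * s := by
    have hproj : IsProjection GA (MvPolynomial.map (Int.castRingHom A) F) := by
      refine ⟨Sum.elim X fun v => C (yA v), fun i => ?_, ?_⟩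
      · rcases i with i | v
        · exact Or.inl ⟨i, rfl⟩
        · exact Or.inr ⟨yA v, rfl⟩
      · rw [show Int.castRingHom A = algebraMap ℤ A from Subsingleton.elim _ _,
          aeval_map_algebraMap]
    calc complexity GA ≤ complexity (MvPolynomial.map (Int.castRingHom A) F) :=
          complexity_le_of_isProjection hproj
      _ ≤ complexity F := ArithCircuit.complexity_map_le _ _
      _ ≤ (skeleton P).size := complexity_le_size (isFanInTwo_skeleton P) rfl
      _ = 3 * s := size_skeleton P
  -- reduction modulo `p`
  let I : Ideal A := Ideal.span ({(p : A)} : Set A)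
  let B := A ⧸ I
  let π : A →+* B := Ideal.Quotient.mk I
  have hpunit : ¬ IsUnit ((p : A)) := not_isUnit_natCast_prime A hAint p hp
  haveI hchar : CharP B p := CharP.quotient A p (mem_nonunits_iff.mpr hpunit)
  letI : Algebra (ZMod p) B := ZMod.algebra B p
  haveI : Nontrivial B := CharP.nontrivial_of_char_ne_one hp.ne_one
  obtain ⟨hBfin, hBrank⟩ := finite_and_finrank_zmod_quotient_le A I p
  haveI := hBfin
  let GB : MvPolynomial (Fin n) B := MvPolynomial.map π GA
  have hGBval : ∀ x, eval (boolPoint B x) GB = (φ x : B) := by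
    intro x
    rw [show GB = MvPolynomial.map π GA from rfl, ← ringHom_eval_boolPoint, hGAval, map_natCast]
  have hcGB : complexity GB ≤ 3 * s := (ArithCircuit.complexity_map_le π GA).trans hcGA
  -- a functional with `ℓ 1 = 1`
  obtain ⟨ψ, hψ⟩ : ∃ ψ : Module.Dual (ZMod p) B, ψ 1 ≠ 0 := by
    by_contra h
    push Not at h
    exact one_ne_zero ((Module.forall_dual_apply_eq_zero_iff (ZMod p) (1 : B)).1 h)
  let ℓ : B →ₗ[ZMod p] ZMod p := (ψ 1)⁻¹ • ψ
  have hℓ1 : ℓ 1 = 1 := by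
    simp only [ℓ, LinearMap.smul_apply, smul_eq_mul, inv_mul_cancel₀ hψ]
  -- the simulated polynomial over `ZMod p`
  let q : MvPolynomial (Fin n) (ZMod p) := CommExtSim.lmap ℓ GB
  have hqval : ∀ x, eval (boolPoint (ZMod p) x) q = (φ x : ZMod p) := by
    intro x
    rw [show q = CommExtSim.lmap ℓ GB from rfl, eval_lmap]
    have hb : (fun i => algebraMap (ZMod p) B (boolPoint (ZMod p) x i)) = boolPoint B x := by
      funext i; by_cases h : x i <;> simp [boolPoint_apply, h]
    rw [hb, hGBval x]
    rw [show ((φ x : ℕ) : B) = algebraMap (ZMod p) B (φ x : ZMod p) by rw [map_natCast],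
      Algebra.algebraMap_eq_smul_one, map_smul, hℓ1, smul_eq_mul, mul_one]
  have hcq : complexity q ≤ (5 * Module.finrank ℚ K ^ 3 + 6 * Module.finrank ℚ K ^ 2 +
      2 * Module.finrank ℚ K) * (3 * s) + 3 * Module.finrank ℚ K := by
    have h := CommExtSim.complexity_lmap_le (Module.finBasis (ZMod p) B) ℓ GB
    rw [Fintype.card_fin] at h
    set d := Module.finrank (ZMod p) B
    have hdD : d ≤ Module.finrank ℚ K := hBrank.trans hrank
    refine h.trans ?_
    gcongr
  obtain ⟨Q, hQ2, hQc, hQs⟩ := exists_computes_size_eq_complexity q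
  refine ⟨Q, hQ2, hQs ▸ hcq, fun x => ?_⟩
  rw [show Q.eval = q from hQc]
  exact hqval x

end Summit.ValiantsHypothesis.ValiantsHypothesis.Theorems.NumTame

end
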